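import Summits.QuantumFields.YangMills.Theorems.UnitScaleTiltProp7Lane2PartitionOfUnity
import Summits.QuantumFields.YangMills.Theorems.UnitScaleTiltProp7QprimeCombL2Defs
import Literature.MathematicalPhysics.QuantumFieldTheory.Balaban1983to89.B5Eq118OneStroke
import HarnessLib

/-!
# Route `UnitScaleTilt`, crux K1 «MinimiserStabilityRegPr» (stmt-QuantumFields-19200) — route-R E′ (A′), LANE II «DIVERGENCE RECOVERY AT CURVED `W`» (★★OWNER RULING №23),
# (B7)∕(B6) bookkeeping «THE SECOND CUTOFF `ζ̃_i`»: **a PLATEAU cutoff family on the member's fine torus, in the letters of ✓p705373 `…Lane2PartitionOfUnity` — for every centre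
# `c`, `ζ̃_c(x) = Π_κ h(dist(x_κ, c_κ))` with the piecewise-linear plateau hat `h(d) = max 0 (min 1 ((P + T − d)∕T))`, `P = (R+3)ℓ`, `T = Rℓ∕2` (`R = L^s`, `ℓ = L^{K−n}`):
# `0 ≤ ζ̃ ≤ 1`; `ζ̃_c = 1` on the sup-cyclic cube of radius `(R+3)ℓ` (the PLATEAU); `ζ̃_c = 0` off the cube of radius `(R+3)ℓ + Rℓ∕2 ≤ (2R−1)ℓ` (`R ≥ 8`); steps
# `|ζ̃_c(x ± e_μ) − ζ̃_c(x)| ≤ 2(Rℓ)⁻¹`; and the two SUPPORT LEMMAS the (B7) budget reads — `ζ̃_c = 1` on the `3ℓ`-neighbourhood of `supp ζ_c` (so on every `[D_W,ζ_c]`∕`[Δ_W,ζ_c]`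
# support), and `ζ̃_c = 1` on every fine site whose `(K−n)`-block (`iterBlockOf`, the read-set letter of ✓`Prop7CmapTwSReadSet`) is within coarse sup-distance `R + 2` of the
# centre's block (so on every `Q_k` stencil of the inner coarse patch)** (★p1 g19 LANE II NAMER WORDS №10 (6) ∕ №11 (2), 2026-08-29; the member geometry of record:
# patches of radius `2R+1` blocks, p.o.u. `ζ` radius `R`, `ζ̃ ≡ 1` on radius `R+3`, `supp ζ̃ ⊆` radius `2R−1`, inner coarse patch radius `R+2`∕`R+3`, `R ≥ 8`).

Cell `ym3-torus` ∕ width seat `ym3-torus-px9` (gen 7, «width 9»).  THEOREMS ONLY (0 `def`, 0 `sorry`; the cutoff is written INLINE); `--supports stmt-QuantumFields-19200 --as helper`,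
count-neutral.  YM₃ on T³ is a ladder rung (R3), not d = 4, not the Clay problem; nothing here claims (B6), (B7), the divergence-recovery row (REC), `hN06`, E′, EX or the gap.

WHY.  In the (REC) assembly ((B7-CORE) ✓p706775∕p707675 with `T := Q_k`, (B7-BUDGET) ✓p708710) the two localisation remainders `ζ_i r_i` and `[D_W, ζ_i]φ_i` are paid in the
`H¹` currency through the global row (QH1) and the product rules (B1″); to localise those payments to the patch one multiplies by a second cutoff `ζ̃_i` that is IDENTICALLY `1`
where the remainders and the `Q_k`-stencils of the inner coarse patch live, vanishes two blocks inside the patch, and has gradient `O((Rℓ)⁻¹)`.  The smoothstep p.o.u. `ζ` of (B6)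
has no plateau; this file supplies the plateau family in the SAME letters (cyclic distance `min (x κ − c κ).val (c κ − x κ).val` on `Site (F.P K) 0`, steps `x.shift μ`∕`x.unshift μ`,
`M = L^s·L^{K−n}`), so that (B6)'s support row `ζ_c x ≠ 0 → ∀ κ, dist < M` feeds lemma (S1) by `exact`.  Periodicity is automatic (functions on the torus).

WHAT IS PROVED (ns `…Theorems.Prop7Lane2PlateauCutoff`):
* §1 (the cycle `ZMod N`): ★ `cycDist_triangle` (triangle inequality of the cyclic distance; `1 < N₀` is inlined from lit∕✓`…ExpMomentSU2T3.one_lt_sitesPerDir`-class facts).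
* §2 (the plateau hat, reals): `plateauHat_mem` (`∈ [0,1]`), `plateauHat_eq_one` (`d ≤ P`), `plateauHat_eq_zero` (`P + T ≤ d`), `lt_of_plateauHat_ne_zero`, ★ `abs_plateauHat_sub_le`
  (`|h d′ − h d| ≤ |d′ − d|∕T`).
* §3 (the family on the member torus, `c x : Site (F.P K) 0`, any centre `c`): ★ `plateauCutoff_mem`, ★★ `plateauCutoff_eq_one` (PLATEAU), ★ `dist_lt_of_plateauCutoff_ne_zero` ∕
  `dist_lt_of_plateauCutoff_ne_zero'` (SUPPORT, `≤ (2R−1)ℓ` form under `8 ≤ L^s`), ★★ `abs_plateauCutoff_shift_sub_le` (STEPS `≤ 2∕(L^s·L^{K−n})`, both directions).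
* §4 (SUPPORT LEMMA S1 — commutators): ★★★ `plateauCutoff_eq_one_of_near_support` — `(∀ κ, dist(x_κ,c_κ) < L^s·L^{K−n}) → (∀ κ, dist(y_κ,x_κ) ≤ 3·L^{K−n}) → ζ̃_c y = 1`
  (the hypothesis is ✓`exists_partitionOfUnity`'s support row at `x`; every `[D_W,ζ_c]`∕`[Δ_W,ζ_c]` stencil is within ONE step of `supp ζ_c`).
* §5 (SUPPORT LEMMA S2 — `Q_k` stencils, read-set letters): `val_corner`, ★★ `dist_le_of_iterBlockOf` (fine cyclic distance to a block CORNER `≤ ℓ·(coarse cyclic distance of the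
  blocks) + (ℓ − 1)`), ★★★ `plateauCutoff_eq_one_of_block_near` (block of `x` within coarse distance `L^s + 2` of `C` ⇒ `ζ̃_{corner C} x = 1`), ★★ `plateauCutoff_eq_one_on_readSet`
  (both endpoints of every fine bond `b` whose blocks lie in `{ĉ₋, ĉ₊}` for a coarse bond `ĉ` with endpoints within `L^s + 2` of `C` — the read predicate of ✓`QTwS_congr_of_agree`),
  `corner_eq_centre` ((B6)'s centres `g·M` ARE block corners of the coarse sites `g·L^s`).
HONEST SCOPE.  Cyclic-distance and clamp bookkeeping; nothing of the lattice gauge theory, of print, of (B6)∕(B7)∕(REC)∕`hN06`∕the crux is asserted; rung R3, not Clay;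
YM gap NOT proved.

References: T. Bałaban, CMP 99 (1985) 389–434 [Balaban1985BackgroundPropagators] ((3.100) pp.413–414: partitions of unity at scale `M` and their commutators; (3.23) p.394);
T. Bałaban, CMP 96 (1984) 223–250 [Balaban1984PropagatorsII] ((1.9) p.226: smooth cutoffs at a lattice scale); [folklore] (clamps, cyclic distance).
-/

set_option autoImplicit false

noncomputable section

open scoped BigOperators

namespace Summit.QuantumFields.YangMills.Theorems.Prop7Lane2PlateauCutoff

open Literature.MathematicalPhysics.QuantumFieldTheory.Balaban1983to89
open Literature.MathematicalPhysics.QuantumFieldTheory.Balaban1983to89.T3ContinuumYM3Torus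
open B5Eq118OneStroke (iterBlockOf val_iterBlockOf)
open Summit.QuantumFields.YangMills.Theorems.Prop7Lane2CyclicHats (dist_eq_min_val dist_add_one_le dist_sub_one_le)
open Summit.QuantumFields.YangMills.Theorems.Prop7QprimeCombL2 (sitesPerDir_zero_eq)

/-! ## §1 The cyclic distance on `ZMod N`: triangle inequality -/

section Cycle

variable {N : ℕ} [NeZero N]

/-- ★ **TRIANGLE INEQUALITY** for the cyclic distance `dist(a,c) = min (a−c).val (c−a).val` on `ZMod N`. [folklore] -/
theorem cycDist_triangle (a b c : ZMod N) :
    min (a - c).val (c - a).val ≤ min (a - b).val (b - a).val + min (b - c).val (c - b).val := by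
  have h1 : (a - c).val ≤ (a - b).val + (b - c).val := by
    have : a - c = (a - b) + (b - c) := by ring
    rw [this]; exact ZMod.val_add_le _ _
  have h2 : (c - a).val ≤ (c - b).val + (b - a).val := by
    have : c - a = (c - b) + (b - a) := by ring
    rw [this]; exact ZMod.val_add_le _ _
  -- the two «difference» representations
  have h3 : (c - b).val ≤ (a - b).val → (a - c).val ≤ (a - b).val := fun h => by
    have : a - c = (a - b) - (c - b) := by ring
    rw [this, ZMod.val_sub h]; omega
  have h4 : (a - b).val ≤ (c - b).val → (c - a).val ≤ (c - b).val := fun h => by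
    have : c - a = (c - b) - (a - b) := by ring
    rw [this, ZMod.val_sub h]; omega
  have h5 : (b - a).val ≤ (b - c).val → (a - c).val ≤ (b - c).val := fun h => by
    have : a - c = (b - c) - (b - a) := by ring
    rw [this, ZMod.val_sub h]; omega
  have h6 : (b - c).val ≤ (b - a).val → (c - a).val ≤ (b - a).val := fun h => by
    have : c - a = (b - a) - (b - c) := by ring
    rw [this, ZMod.val_sub h]; omega
  rcases le_total (c - b).val (a - b).val with hcb | hcb <;>
  rcases le_total (b - a).val (b - c).val with hba | hba <;>
  · have := h3; have := h4; have := h5; have := h6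
    simp only [Nat.min_def]; split_ifs <;> omega

end Cycle

/-! ## §2 The plateau hat `h(d) = max 0 (min 1 ((P + T − d)∕T))` (reals, `T > 0`) -/

section Hat

variable {P T : ℝ} (hT : 0 < T)
include hT

omit hT in
/-- `0 ≤ h(d) ≤ 1`. [folklore] -/
theorem plateauHat_mem (d : ℝ) : 0 ≤ max 0 (min 1 ((P + T - d) / T)) ∧ max 0 (min 1 ((P + T - d) / T)) ≤ 1 :=
  ⟨le_max_left _ _, max_le zero_le_one (min_le_left _ _)⟩

/-- PLATEAU: `d ≤ P ⇒ h(d) = 1`. [folklore] -/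
theorem plateauHat_eq_one {d : ℝ} (hd : d ≤ P) : max 0 (min 1 ((P + T - d) / T)) = 1 := by
  have h1 : 1 ≤ (P + T - d) / T := by rw [le_div_iff₀ hT]; linarith
  rw [min_eq_left h1, max_eq_right zero_le_one]

/-- SUPPORT: `P + T ≤ d ⇒ h(d) = 0`. [folklore] -/
theorem plateauHat_eq_zero {d : ℝ} (hd : P + T ≤ d) : max 0 (min 1 ((P + T - d) / T)) = 0 := by
  have h1 : (P + T - d) / T ≤ 0 := div_nonpos_of_nonpos_of_nonneg (by linarith) hT.le
  rw [min_eq_right (h1.trans zero_le_one), max_eq_left h1]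

/-- `h(d) ≠ 0 ⇒ d < P + T`. [folklore] -/
theorem lt_of_plateauHat_ne_zero {d : ℝ} (h : max 0 (min 1 ((P + T - d) / T)) ≠ 0) : d < P + T := by
  by_contra hd
  exact h (plateauHat_eq_zero hT (not_lt.mp hd))

/-- ★ LIPSCHITZ: `|h(d′) − h(d)| ≤ |d′ − d|∕T` (the clamp is 1-Lipschitz). [folklore] -/
theorem abs_plateauHat_sub_le (d d' : ℝ) :
    |max 0 (min 1 ((P + T - d') / T)) - max 0 (min 1 ((P + T - d) / T))| ≤ |d' - d| / T := by
  calc |max 0 (min 1 ((P + T - d') / T)) - max 0 (min 1 ((P + T - d) / T))|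
      ≤ max |(0 : ℝ) - 0| |min 1 ((P + T - d') / T) - min 1 ((P + T - d) / T)| := abs_max_sub_max_le_max _ _ _ _
    _ ≤ max |(0 : ℝ) - 0| (max |(1 : ℝ) - 1| |(P + T - d') / T - (P + T - d) / T|) :=
        max_le_max le_rfl (abs_min_sub_min_le_max _ _ _ _)
    _ = |d' - d| / T := by
        rw [sub_self, sub_self, abs_zero]
        have h : (P + T - d') / T - (P + T - d) / T = -((d' - d) / T) := by ring
        rw [h, abs_neg, abs_div, abs_of_pos hT, max_eq_right (by positivity), max_eq_right (by positivity)]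

end Hat

/-! ## §3 The plateau cutoff family on the member's fine torus -/

section Member

variable (F : T3Family) (n K s : ℕ)

/-- Positivity of the ramp `T = L^s·L^{K−n}∕2`. [folklore] -/
theorem ramp_pos : 0 < ((F.L : ℝ) ^ s * (F.L : ℝ) ^ (K - n) / 2) := by
  have hL : (0 : ℝ) < F.L := by have := F.hL.2; exact_mod_cast (show 0 < F.L by omega)
  positivity

/-- ★ `0 ≤ ζ̃_c(x) ≤ 1`. [folklore] -/
theorem plateauCutoff_mem (c x : Site (F.P K) 0) : 0 ≤ (∏ κ : Fin 3, max 0 (min 1 (((((F.L : ℝ) ^ s + 3) * (F.L : ℝ) ^ (K - n)) + ((F.L : ℝ) ^ s * (F.L : ℝ) ^ (K - n) / 2) - ((min (x κ - c κ).val (c κ - x κ).val : ℕ) : ℝ)) / ((F.L : ℝ) ^ s * (F.L : ℝ) ^ (K - n) / 2)))) ∧ (∏ κ : Fin 3, max 0 (min 1 (((((F.L : ℝ) ^ s + 3) * (F.L : ℝ) ^ (K - n)) + ((F.L : ℝ) ^ s * (F.L : ℝ) ^ (K - n) / 2) - ((min (x κ - c κ).val (c κ - x κ).val : ℕ) : ℝ))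 / ((F.L : ℝ) ^ s * (F.L : ℝ) ^ (K - n) / 2)))) ≤ 1 :=
  ⟨Finset.prod_nonneg fun _ _ => (plateauHat_mem _).1,
   Finset.prod_le_one (fun _ _ => (plateauHat_mem _).1) fun _ _ => (plateauHat_mem _).2⟩

/-- ★★ **PLATEAU**: `ζ̃_c(x) = 1` whenever every coordinate of `x` is within cyclic distance `(L^s + 3)·L^{K−n}` of `c`. [cite: Balaban1985BackgroundPropagators, (3.100) p.413] -/
theorem plateauCutoff_eq_one (c x : Site (F.P K) 0) (hx : ∀ κ : Fin 3, ((min (x κ - c κ).val (c κ - x κ).val : ℕ) : ℝ) ≤ (((F.L : ℝ) ^ s + 3) * (F.L : ℝ) ^ (K - n))) : (∏ κ : Fin 3, max 0 (min 1 (((((F.L : ℝ) ^ s + 3) * (F.L : ℝ) ^ (K - n)) + ((F.L : ℝ) ^ s * (F.L : ℝ) ^ (K - n) / 2) - ((min (x κ - c κ).val (c κ - x κ).val : ℕ) : ℝ)) / ((F.L : ℝ) ^ s * (F.L : ℝ) ^ (K - n) / 2)))) = 1 :=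
  Finset.prod_eq_one fun κ _ => plateauHat_eq_one (ramp_pos F n K s) (hx κ)

/-- ★ **SUPPORT**: `ζ̃_c(x) ≠ 0 ⇒` every coordinate of `x` is within cyclic distance `< (L^s + 3)·L^{K−n} + L^s·L^{K−n}∕2` of `c`. [folklore] -/
theorem dist_lt_of_plateauCutoff_ne_zero (c x : Site (F.P K) 0) (h : (∏ κ : Fin 3, max 0 (min 1 (((((F.L : ℝ) ^ s + 3) * (F.L : ℝ) ^ (K - n)) + ((F.L : ℝ) ^ s * (F.L : ℝ) ^ (K - n) / 2) - ((min (x κ - c κ).val (c κ - x κ).val : ℕ) : ℝ)) / ((F.L : ℝ) ^ s * (F.L : ℝ) ^ (K - n) / 2)))) ≠ 0) :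
    ∀ κ : Fin 3, ((min (x κ - c κ).val (c κ - x κ).val : ℕ) : ℝ) < (((F.L : ℝ) ^ s + 3) * (F.L : ℝ) ^ (K - n)) + ((F.L : ℝ) ^ s * (F.L : ℝ) ^ (K - n) / 2) := fun κ =>
  lt_of_plateauHat_ne_zero (ramp_pos F n K s) (Finset.prod_ne_zero_iff.mp h κ (Finset.mem_univ κ))

/-- SUPPORT, the form of record: with `R = L^s ≥ 8`, `supp ζ̃_c` lies in the open cube of radius `(2R − 1)·L^{K−n}` (two blocks inside the patch of radius `2R + 1`). [folklore] -/
theorem dist_lt_of_plateauCutoff_ne_zero' (hR : 8 ≤ F.L ^ s) (c x : Site (F.P K) 0) (h : (∏ κ : Fin 3, max 0 (min 1 (((((F.L : ℝ) ^ s + 3) * (F.L : ℝ) ^ (K - n)) + ((F.L : ℝ) ^ s * (F.L : ℝ) ^ (K - n) / 2) - ((min (x κ - c κ).val (c κ - x κ).val : ℕ) : ℝ)) / ((F.L : ℝ) ^ s * (F.L : ℝ) ^ (K - n) / 2)))) ≠ 0) :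
    ∀ κ : Fin 3, ((min (x κ - c κ).val (c κ - x κ).val : ℕ) : ℝ) < (2 * (F.L : ℝ) ^ s - 1) * (F.L : ℝ) ^ (K - n) := fun κ => by
  have h1 := dist_lt_of_plateauCutoff_ne_zero F n K s c x h κ
  have hR' : (8 : ℝ) ≤ (F.L : ℝ) ^ s := by exact_mod_cast hR
  have hℓ : (0 : ℝ) < (F.L : ℝ) ^ (K - n) := by
    have hL : (0 : ℝ) < F.L := by have := F.hL.2; exact_mod_cast (show 0 < F.L by omega)
    positivity
  nlinarith

/-- ★★ **STEPS**: `|ζ̃_c(x + e_μ) − ζ̃_c(x)| ≤ 2∕(L^s·L^{K−n})` and the same for `x − e_μ` (one factor moves by `≤ 1∕T`, the others lie in `[0,1]`).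
[cite: Balaban1985BackgroundPropagators, (3.100) p.414] -/
theorem abs_plateauCutoff_shift_sub_le (c x : Site (F.P K) 0) (μ : Fin 3) :
    |(∏ κ : Fin 3, max 0 (min 1 (((((F.L : ℝ) ^ s + 3) * (F.L : ℝ) ^ (K - n)) + ((F.L : ℝ) ^ s * (F.L : ℝ) ^ (K - n) / 2) - ((min ((x.shift μ) κ - c κ).val (c κ - (x.shift μ) κ).val : ℕ) : ℝ)) / ((F.L : ℝ) ^ s * (F.L : ℝ) ^ (K - n) / 2)))) - (∏ κ : Fin 3, max 0 (min 1 (((((F.L : ℝ) ^ s + 3) * (F.L : ℝ) ^ (K - n)) + ((F.L : ℝ) ^ s * (F.L : ℝ) ^ (K - n) / 2) - ((min (x κ - c κ).val (c κ - x κ).val : ℕ) : ℝ)) / ((F.L : ℝ) ^ s * (F.L : ℝ) ^ (K - n) / 2))))| ≤ 2 / ((F.L : ℝ) ^ s * (F.L : ℝ) ^ (K - n)) ∧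
      |(∏ κ : Fin 3, max 0 (min 1 (((((F.L : ℝ) ^ s + 3) * (F.L : ℝ) ^ (K - n)) + ((F.L : ℝ) ^ s * (F.L : ℝ) ^ (K - n) / 2) - ((min ((x.unshift μ) κ - c κ).val (c κ - (x.unshift μ) κ).val : ℕ) : ℝ)) / ((F.L : ℝ) ^ s * (F.L : ℝ) ^ (K - n) / 2)))) - (∏ κ : Fin 3, max 0 (min 1 (((((F.L : ℝ) ^ s + 3) * (F.L : ℝ) ^ (K - n)) + ((F.L : ℝ) ^ s * (F.L : ℝ) ^ (K - n) / 2) - ((min (x κ - c κ).val (c κ - x κ).val : ℕ) : ℝ)) / ((F.L : ℝ) ^ s * (F.L : ℝ) ^ (K - n) / 2))))| ≤ 2 / ((F.L : ℝ) ^ s * (F.L : ℝ) ^ (K - n)) := by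
  have hN : 1 < (F.P K).sitesPerDir 0 :=
    (by show 1 < 2 * F.L ^ (F.m + K - 0); have := Nat.one_le_pow (F.m + K - 0) F.L (by have := F.hL.2; omega); omega)
  have hT := ramp_pos F n K s
  -- generic: replacing the `μ`-th factor of a product of `[0,1]`-numbers moves the product by at most the move of that factor
  have key : ∀ y : Site (F.P K) 0, (∀ κ, κ ≠ μ → y κ = x κ) → (((min (y μ - c μ).val (c μ - y μ).val : ℕ) : ℝ) ≤ (min (x μ - c μ).val (c μ - x μ).val : ℕ) + 1) →
      (((min (x μ - c μ).val (c μ - x μ).val : ℕ) : ℝ) ≤ (min (y μ - c μ).val (c μ - y μ).val : ℕ) + 1) →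
      |(∏ κ : Fin 3, max 0 (min 1 (((((F.L : ℝ) ^ s + 3) * (F.L : ℝ) ^ (K - n)) + ((F.L : ℝ) ^ s * (F.L : ℝ) ^ (K - n) / 2) - ((min (y κ - c κ).val (c κ - y κ).val : ℕ) : ℝ)) / ((F.L : ℝ) ^ s * (F.L : ℝ) ^ (K - n) / 2)))) - (∏ κ : Fin 3, max 0 (min 1 (((((F.L : ℝ) ^ s + 3) * (F.L : ℝ) ^ (K - n)) + ((F.L : ℝ) ^ s * (F.L : ℝ) ^ (K - n) / 2) - ((min (x κ - c κ).val (c κ - x κ).val : ℕ) : ℝ)) / ((F.L : ℝ) ^ s * (F.L : ℝ) ^ (K - n) / 2))))| ≤ 2 / ((F.L : ℝ) ^ s * (F.L : ℝ) ^ (K - n)) := by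
    intro y hy h1 h2
    rw [← Finset.prod_erase_mul _ _ (Finset.mem_univ μ), ← Finset.prod_erase_mul _ _ (Finset.mem_univ μ)]
    have hrest : ∏ κ ∈ Finset.univ.erase μ, max 0 (min 1 (((((F.L : ℝ) ^ s + 3) * (F.L : ℝ) ^ (K - n)) + ((F.L : ℝ) ^ s * (F.L : ℝ) ^ (K - n) / 2) - ((min (y κ - c κ).val (c κ - y κ).val : ℕ) : ℝ)) / ((F.L : ℝ) ^ s * (F.L : ℝ) ^ (K - n) / 2))) = ∏ κ ∈ Finset.univ.erase μ, max 0 (min 1 (((((F.L : ℝ) ^ s + 3) * (F.L : ℝ) ^ (K - n)) + ((F.L : ℝ) ^ s * (F.L : ℝ) ^ (K - n) / 2) - ((min (x κ - c κ).val (c κ - x κ).val : ℕ) : ℝ)) / ((F.L : ℝ) ^ s * (F.L : ℝ) ^ (K - n) / 2))) :=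
      Finset.prod_congr rfl fun κ hκ => by rw [hy κ (Finset.ne_of_mem_erase hκ)]
    rw [hrest, ← mul_sub, abs_mul]
    have hP0 : 0 ≤ ∏ κ ∈ Finset.univ.erase μ, max 0 (min 1 (((((F.L : ℝ) ^ s + 3) * (F.L : ℝ) ^ (K - n)) + ((F.L : ℝ) ^ s * (F.L : ℝ) ^ (K - n) / 2) - ((min (x κ - c κ).val (c κ - x κ).val : ℕ) : ℝ)) / ((F.L : ℝ) ^ s * (F.L : ℝ) ^ (K - n) / 2))) := Finset.prod_nonneg fun κ _ => (plateauHat_mem _).1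
    have hP1 : ∏ κ ∈ Finset.univ.erase μ, max 0 (min 1 (((((F.L : ℝ) ^ s + 3) * (F.L : ℝ) ^ (K - n)) + ((F.L : ℝ) ^ s * (F.L : ℝ) ^ (K - n) / 2) - ((min (x κ - c κ).val (c κ - x κ).val : ℕ) : ℝ)) / ((F.L : ℝ) ^ s * (F.L : ℝ) ^ (K - n) / 2))) ≤ 1 :=
      Finset.prod_le_one (fun κ _ => (plateauHat_mem _).1) fun κ _ => (plateauHat_mem _).2
    have hfac := abs_plateauHat_sub_le (P := (((F.L : ℝ) ^ s + 3) * (F.L : ℝ) ^ (K - n))) hT ((min (x μ - c μ).val (c μ - x μ).val : ℕ) : ℝ) ((min (y μ - c μ).val (c μ - y μ).val : ℕ) : ℝ)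
    have hd : |(((min (y μ - c μ).val (c μ - y μ).val : ℕ) : ℝ)) - ((min (x μ - c μ).val (c μ - x μ).val : ℕ) : ℝ)| ≤ 1 := abs_sub_le_iff.mpr ⟨by linarith, by linarith⟩
    rw [abs_of_nonneg hP0]
    calc (∏ κ ∈ Finset.univ.erase μ, max 0 (min 1 (((((F.L : ℝ) ^ s + 3) * (F.L : ℝ) ^ (K - n)) + ((F.L : ℝ) ^ s * (F.L : ℝ) ^ (K - n) / 2) - ((min (x κ - c κ).val (c κ - x κ).val : ℕ) : ℝ)) / ((F.L : ℝ) ^ s * (F.L : ℝ) ^ (K - n) / 2)))) * |max 0 (min 1 (((((F.L : ℝ) ^ s + 3) * (F.L : ℝ) ^ (K - n)) + ((F.L : ℝ) ^ s * (F.L : ℝ) ^ (K - n) / 2) - ((min (y μ - c μ).val (c μ - y μ).val : ℕ) : ℝ)) / ((F.L : ℝ) ^ s * (F.L : ℝ) ^ (K - n) / 2))) - max 0 (min 1 (((((F.L : ℝ) ^ s + 3) * (F.L : ℝ) ^ (K - n)) + ((F.L : ℝ) ^ s * (F.L : ℝ) ^ (K - n) / 2) - ((min (x μ - c μ).val (c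 μ - x μ).val : ℕ) : ℝ)) / ((F.L : ℝ) ^ s * (F.L : ℝ) ^ (K - n) / 2)))|
        ≤ 1 * (1 / ((F.L : ℝ) ^ s * (F.L : ℝ) ^ (K - n) / 2)) := by
          apply mul_le_mul hP1 (hfac.trans (div_le_div_of_nonneg_right hd hT.le)) (abs_nonneg _) zero_le_one
      _ = 2 / ((F.L : ℝ) ^ s * (F.L : ℝ) ^ (K - n)) := by field_simp
  constructor
  · refine key (x.shift μ) (fun κ hκ => show Function.update x μ (x μ + 1) κ = x κ from Function.update_of_ne hκ _ _) ?_ ?_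
    · have h := (dist_add_one_le hN (x μ) (c μ)).1
      have e : x.shift μ μ = x μ + 1 := by simp [Site.shift]
      rw [e]; exact_mod_cast h
    · have h := (dist_add_one_le hN (x μ) (c μ)).2
      have e : x.shift μ μ = x μ + 1 := by simp [Site.shift]
      rw [e]; exact_mod_cast h
  · refine key (x.unshift μ) (fun κ hκ => show Function.update x μ (x μ - 1) κ = x κ from Function.update_of_ne hκ _ _) ?_ ?_
    · have h := (dist_sub_one_le hN (x μ) (c μ)).1
      have e : x.unshift μ μ = x μ - 1 := by simp [Site.unshift]
      rw [e]; exact_mod_cast h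
    · have h := (dist_sub_one_le hN (x μ) (c μ)).2
      have e : x.unshift μ μ = x μ - 1 := by simp [Site.unshift]
      rw [e]; exact_mod_cast h

/-! ## §4 SUPPORT LEMMA S1: `ζ̃_c = 1` on the `3ℓ`-neighbourhood of `supp ζ_c` (every commutator stencil) -/

/-- ★★★ **S1**: if `x` is in the support cube of (B6)'s `ζ_c` (✓`exists_partitionOfUnity`: `ζ_c x ≠ 0 → ∀ κ, dist(x_κ, c_κ) < L^s·L^{K−n}`) and `y` is within cyclic
sup-distance `3·L^{K−n}` of `x`, then `ζ̃_c y = 1`.  In particular `ζ̃_c = 1` at both ends of every bond on which `ζ_c` is not constant, and at `x, x ± e_μ` wherever the second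
difference of `ζ_c` is read: the supports of `[D_W, ζ_c]` and `[Δ_W, ζ_c]` sit in the plateau. [cite: Balaban1985BackgroundPropagators, (3.100) pp.413-414] -/
theorem plateauCutoff_eq_one_of_near_support (c x y : Site (F.P K) 0)
    (hx : ∀ κ : Fin 3, (min (x κ - c κ).val (c κ - x κ).val : ℕ) < F.L ^ s * F.L ^ (K - n))
    (hy : ∀ κ : Fin 3, (min (y κ - x κ).val (x κ - y κ).val : ℕ) ≤ 3 * F.L ^ (K - n)) :
    (∏ κ : Fin 3, max 0 (min 1 (((((F.L : ℝ) ^ s + 3) * (F.L : ℝ) ^ (K - n)) + ((F.L : ℝ) ^ s * (F.L : ℝ) ^ (K - n) / 2) - ((min (y κ - c κ).val (c κ - y κ).val : ℕ) : ℝ)) / ((F.L : ℝ) ^ s * (F.L : ℝ) ^ (K - n) / 2)))) = 1 := by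
  haveI : NeZero ((F.P K).sitesPerDir 0) :=
    ⟨by have h1 : 1 < (F.P K).sitesPerDir 0 := (by show 1 < 2 * F.L ^ (F.m + K - 0); have := Nat.one_le_pow (F.m + K - 0) F.L (by have := F.hL.2; omega); omega); omega⟩
  refine plateauCutoff_eq_one F n K s c y fun κ => ?_
  have ht := cycDist_triangle (y κ) (x κ) (c κ)
  have h1 := hx κ
  have h2 := hy κ
  have h3 : (min (y κ - c κ).val (c κ - y κ).val : ℕ) + 1 ≤ 3 * F.L ^ (K - n) + F.L ^ s * F.L ^ (K - n) := by omega
  have h4 : (((min (y κ - c κ).val (c κ - y κ).val : ℕ) : ℝ)) + 1 ≤ 3 * (F.L : ℝ) ^ (K - n) + (F.L : ℝ) ^ s * (F.L : ℝ) ^ (K - n) := by exact_mod_cast h3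
  nlinarith

/-! ## §5 SUPPORT LEMMA S2: blocks near the centre's block are in the plateau (read-set letters `iterBlockOf`) -/

/-- The value of a block CORNER: for a coarse site `C` at level `K − n`, the fine site `κ ↦ (C κ).val·L^{K−n}` has exactly that value (`N₀ = L^{K−n}·N_{K−n}`). [folklore] -/
theorem val_corner (hnK : n ≤ K) (C : Site (F.P K) (K - n)) (κ : Fin 3) :
    ((((C κ).val * F.L ^ (K - n) : ℕ) : ZMod ((F.P K).sitesPerDir 0))).val = (C κ).val * F.L ^ (K - n) := by
  have hℓpos : 0 < F.L ^ (K - n) := pow_pos (by have := F.hL.2; omega) _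
  have hlt : (C κ).val * F.L ^ (K - n) < (F.P K).sitesPerDir 0 := by
    rw [sitesPerDir_zero_eq F n K hnK, show (F.P K).L = F.L from rfl, mul_comm (F.L ^ (K - n))]
    exact Nat.mul_lt_mul_of_pos_right (ZMod.val_lt (C κ)) hℓpos
  rw [ZMod.val_natCast, Nat.mod_eq_of_lt hlt]

/-- ★★ **FINE DISTANCE TO A BLOCK CORNER vs COARSE DISTANCE OF THE BLOCKS**: with `Y := iterBlockOf (K−n) x` (the block of `x`) and the corner `cC κ = (C κ).val·ℓ` of a coarse site `C`,
`dist(x_κ, cC_κ) ≤ ℓ·dist(Y_κ, C_κ) + (ℓ − 1)` (`ℓ = L^{K−n}`; `x_κ.val = Y_κ.val·ℓ + r`, `r < ℓ`). [cite: Balaban1984PropagatorsI, (1.6) p.18] -/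
theorem dist_le_of_iterBlockOf (hnK : n ≤ K) (C : Site (F.P K) (K - n)) (x : Site (F.P K) 0) (κ : Fin 3) :
    min (x κ - (((C κ).val * F.L ^ (K - n) : ℕ) : ZMod ((F.P K).sitesPerDir 0))).val
        ((((C κ).val * F.L ^ (K - n) : ℕ) : ZMod ((F.P K).sitesPerDir 0)) - x κ).val
      ≤ F.L ^ (K - n) * min ((iterBlockOf (K - n) x) κ - C κ).val (C κ - (iterBlockOf (K - n) x) κ).val + (F.L ^ (K - n) - 1) := by
  haveI : NeZero ((F.P K).sitesPerDir 0) :=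
    ⟨by have h1 : 1 < (F.P K).sitesPerDir 0 := (by show 1 < 2 * F.L ^ (F.m + K - 0); have := Nat.one_le_pow (F.m + K - 0) F.L (by have := F.hL.2; omega); omega); omega⟩
  set ℓ : ℕ := F.L ^ (K - n) with hℓ
  set Nc : ℕ := (F.P K).sitesPerDir (K - n) with hNc
  set Y := iterBlockOf (K - n) x with hY
  have hℓpos : 0 < ℓ := pow_pos (by have := F.hL.2; omega) _
  have hN0 : (F.P K).sitesPerDir 0 = ℓ * Nc := by rw [sitesPerDir_zero_eq F n K hnK]; rfl
  have hYval : (Y κ).val = (x κ).val / ℓ := val_iterBlockOf (P := F.P K) (K - n) (by show K - n ≤ F.m + K; omega) x κ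
  set cc : ZMod ((F.P K).sitesPerDir 0) := (((C κ).val * ℓ : ℕ) : ZMod ((F.P K).sitesPerDir 0)) with hcc
  have hCval : cc.val = (C κ).val * ℓ := val_corner F n K hnK C κ
  have hClt : (C κ).val < Nc := ZMod.val_lt _
  have hYlt : (Y κ).val < Nc := ZMod.val_lt _
  -- Euclidean division of the fine label: `a = (Y κ).val·ℓ + r`
  set a := (x κ).val with ha
  set r := a % ℓ with hr
  have hdecomp : a = (Y κ).val * ℓ + r := by rw [hYval, hr, mul_comm]; exact (Nat.div_add_mod a ℓ).symm
  have hrlt : r < ℓ := Nat.mod_lt _ hℓpos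
  rw [dist_eq_min_val, dist_eq_min_val (Y κ) (C κ)]
  rcases Nat.lt_or_ge (Y κ).val (C κ).val with hlt | hle
  swap
  · -- no wrap: `(x − cc).val = ℓ·q + r`, `(Y − C).val = q`, `q = (Y κ).val − (C κ).val`
    set q := (Y κ).val - (C κ).val with hqdef
    have hqNc : q < Nc := by omega
    have hmul : (Y κ).val * ℓ = (C κ).val * ℓ + ℓ * q := by
      rw [hqdef]; zify [hle]; ring
    have hYC : (Y κ - C κ).val = q := ZMod.val_sub hle
    have hxc : (x κ - cc).val = ℓ * q + r := by
      rw [ZMod.val_sub (by rw [hCval]; omega), hCval]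
      omega
    rw [hxc, hYC, hN0]
    rcases le_total q (Nc - q) with hmin | hmin
    · rw [min_eq_left hmin]
      refine (min_le_left _ _).trans ?_
      omega
    · rw [min_eq_right hmin]
      refine (min_le_right _ _).trans ?_
      have e1 : ℓ * (Nc - q) + ℓ * q = ℓ * Nc := by rw [← mul_add, Nat.sub_add_cancel hqNc.le]
      omega
  · -- wrap: `(cc − x).val = ℓ·q′ − r`, `(C − Y).val = q′`, `q′ = (C κ).val − (Y κ).val ≥ 1`
    set q' := (C κ).val - (Y κ).val with hqdef
    have hq1 : 1 ≤ q' := by omega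
    have hqNc : q' < Nc := by omega
    have hℓq : ℓ ≤ ℓ * q' := Nat.le_mul_of_pos_right _ hq1
    have hmul : (C κ).val * ℓ = (Y κ).val * ℓ + ℓ * q' := by
      rw [hqdef]; zify [hlt.le]; ring
    have hCY : (C κ - Y κ).val = q' := ZMod.val_sub hlt.le
    have hcx : (cc - x κ).val = ℓ * q' - r := by
      rw [ZMod.val_sub (by rw [hCval]; omega), hCval]
      omega
    have hxc : (x κ - cc).val = (F.P K).sitesPerDir 0 - (ℓ * q' - r) := by
      have e : x κ - cc = -(cc - x κ) := by ring
      have hne : cc - x κ ≠ 0 := by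
        intro h0
        have := congrArg ZMod.val h0
        rw [hcx, ZMod.val_zero] at this
        omega
      rw [e, ZMod.neg_val, if_neg hne, hcx]
    have hYC : (Y κ - C κ).val = Nc - q' := by
      have e : Y κ - C κ = -(C κ - Y κ) := by ring
      have hne : C κ - Y κ ≠ 0 := by
        intro h0; have := congrArg ZMod.val h0; rw [hCY, ZMod.val_zero] at this; omega
      rw [e, ZMod.neg_val, if_neg hne, hCY]
    rw [hxc, hYC, hN0]
    have e1 : ℓ * (Nc - q') + ℓ * q' = ℓ * Nc := by rw [← mul_add, Nat.sub_add_cancel hqNc.le]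
    have e2 : ℓ * (Nc - (Nc - q')) = ℓ * q' := by rw [Nat.sub_sub_self hqNc.le]
    rcases le_total (Nc - q') (Nc - (Nc - q')) with hmin | hmin
    · rw [min_eq_left hmin]
      refine (min_le_left _ _).trans ?_
      omega
    · rw [min_eq_right hmin, e2]
      refine (min_le_right _ _).trans ?_
      omega

/-- ★★★ **S2 — BLOCKS NEAR THE CENTRE'S BLOCK ARE IN THE PLATEAU**: if the `(K−n)`-block `iterBlockOf (K−n) x` of the fine site `x` is within coarse cyclic sup-distance `L^s + 2`
of the coarse site `C`, then `ζ̃_{cC} x = 1` for the cutoff centred at the block corner `cC κ = (C κ).val·L^{K−n}` (so every `Q_k` stencil of the inner coarse patch of radius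
`R + 2 = L^s + 2` blocks lies where `ζ̃ = 1`). [cite: Balaban1985BackgroundPropagators, (3.100) p.413; Balaban1985Averaging, (110) p.34] -/
theorem plateauCutoff_eq_one_of_block_near (hnK : n ≤ K) (C : Site (F.P K) (K - n)) (x : Site (F.P K) 0)
    (hY : ∀ κ : Fin 3, min ((iterBlockOf (K - n) x) κ - C κ).val (C κ - (iterBlockOf (K - n) x) κ).val ≤ F.L ^ s + 2) :
    (∏ κ : Fin 3, max 0 (min 1 (((((F.L : ℝ) ^ s + 3) * (F.L : ℝ) ^ (K - n)) + ((F.L : ℝ) ^ s * (F.L : ℝ) ^ (K - n) / 2) - ((min (x κ - (fun κ => (((C κ).val * F.L ^ (K - n) : ℕ) : ZMod ((F.P K).sitesPerDir 0))) κ).val ((fun κ => (((C κ).val * F.L ^ (K - n) : ℕ) : ZMod ((F.P K).sitesPerDir 0))) κ - x κ).val : ℕ) : ℝ)) / ((F.L : ℝ) ^ s * (F.L : ℝ) ^ (K - n) / 2)))) = 1 := by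
  refine plateauCutoff_eq_one F n K s _ x fun κ => ?_
  have h1 := dist_le_of_iterBlockOf F n K hnK C x κ
  have h2 := hY κ
  have hℓ1 : 1 ≤ F.L ^ (K - n) := Nat.one_le_pow _ _ (by have := F.hL.2; omega)
  have h3 : min (x κ - (((C κ).val * F.L ^ (K - n) : ℕ) : ZMod ((F.P K).sitesPerDir 0))).val
        ((((C κ).val * F.L ^ (K - n) : ℕ) : ZMod ((F.P K).sitesPerDir 0)) - x κ).val + 1 ≤ (F.L ^ s + 3) * F.L ^ (K - n) := by
    have h5 := Nat.mul_le_mul_left (F.L ^ (K - n)) h2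
    zify [hℓ1] at h1 h5 ⊢
    nlinarith
  have h4 : ((min (x κ - (((C κ).val * F.L ^ (K - n) : ℕ) : ZMod ((F.P K).sitesPerDir 0))).val
        ((((C κ).val * F.L ^ (K - n) : ℕ) : ZMod ((F.P K).sitesPerDir 0)) - x κ).val : ℕ) : ℝ) + 1 ≤ ((F.L : ℝ) ^ s + 3) * (F.L : ℝ) ^ (K - n) := by
    exact_mod_cast h3
  linarith

/-- ★★ **S2 ON THE READ SET** of a coarse bond `ĉ` of the inner patch: if both endpoints of `ĉ` are within coarse sup-distance `L^s + 2` of `C`, then `ζ̃_{cC} = 1` at BOTH ends of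
every fine bond `b` whose endpoint blocks lie in `{ĉ₋, ĉ₊}` — the read predicate of ✓`Prop7CmapTwSReadSet.QTwS_congr_of_agree`. [cite: Balaban1985Averaging, (110) p.34] -/
theorem plateauCutoff_eq_one_on_readSet (hnK : n ≤ K) (C : Site (F.P K) (K - n)) (chat : PBond (F.P K) (K - n))
    (hsrc : ∀ κ : Fin 3, min (chat.src κ - C κ).val (C κ - chat.src κ).val ≤ F.L ^ s + 2)
    (htgt : ∀ κ : Fin 3, min (chat.tgt κ - C κ).val (C κ - chat.tgt κ).val ≤ F.L ^ s + 2)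
    (b : PBond (F.P K) 0)
    (hbs : iterBlockOf (K - n) b.src = chat.src ∨ iterBlockOf (K - n) b.src = chat.tgt)
    (hbt : iterBlockOf (K - n) b.tgt = chat.src ∨ iterBlockOf (K - n) b.tgt = chat.tgt) :
    (∏ κ : Fin 3, max 0 (min 1 (((((F.L : ℝ) ^ s + 3) * (F.L : ℝ) ^ (K - n)) + ((F.L : ℝ) ^ s * (F.L : ℝ) ^ (K - n) / 2) - ((min (b.src κ - (fun κ => (((C κ).val * F.L ^ (K - n) : ℕ) : ZMod ((F.P K).sitesPerDir 0))) κ).val ((fun κ => (((C κ).val * F.L ^ (K - n) : ℕ) : ZMod ((F.P K).sitesPerDir 0))) κ - b.src κ).val : ℕ) : ℝ)) / ((F.L : ℝ) ^ s * (F.L : ℝ) ^ (K - n) / 2)))) = 1 ∧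
      (∏ κ : Fin 3, max 0 (min 1 (((((F.L : ℝ) ^ s + 3) * (F.L : ℝ) ^ (K - n)) + ((F.L : ℝ) ^ s * (F.L : ℝ) ^ (K - n) / 2) - ((min (b.tgt κ - (fun κ => (((C κ).val * F.L ^ (K - n) : ℕ) : ZMod ((F.P K).sitesPerDir 0))) κ).val ((fun κ => (((C κ).val * F.L ^ (K - n) : ℕ) : ZMod ((F.P K).sitesPerDir 0))) κ - b.tgt κ).val : ℕ) : ℝ)) / ((F.L : ℝ) ^ s * (F.L : ℝ) ^ (K - n) / 2)))) = 1 := by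
  constructor
  · refine plateauCutoff_eq_one_of_block_near F n K s hnK C b.src fun κ => ?_
    rcases hbs with h | h <;> rw [h]
    exacts [hsrc κ, htgt κ]
  · refine plateauCutoff_eq_one_of_block_near F n K s hnK C b.tgt fun κ => ?_
    rcases hbt with h | h <;> rw [h]
    exacts [hsrc κ, htgt κ]

/-- (B6)'s centres ARE block corners: for a grid index `g`, the centre `κ ↦ g_κ·(L^s·L^{K−n})` of ✓`exists_partitionOfUnity` is the corner of the coarse site `κ ↦ g_κ·L^s`
(values below `N_{K−n} = 2L^{m+n}` when `g_κ < 2L^{m+n−s}`, `s ≤ m + n`). [folklore] -/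
theorem corner_eq_centre (hnK : n ≤ K) (hs : s ≤ F.m + n) (g : Fin 3 → ℕ) (hg : ∀ κ, g κ < 2 * F.L ^ (F.m + n - s)) :
    (fun κ : Fin 3 => (((((g κ * F.L ^ s : ℕ) : ZMod ((F.P K).sitesPerDir (K - n)))).val * F.L ^ (K - n) : ℕ) : ZMod ((F.P K).sitesPerDir 0)))
      = fun κ => ((g κ * (F.L ^ s * F.L ^ (K - n)) : ℕ) : ZMod ((F.P K).sitesPerDir 0)) := by
  funext κ
  have hlt : g κ * F.L ^ s < (F.P K).sitesPerDir (K - n) := by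
    show g κ * F.L ^ s < 2 * F.L ^ (F.m + K - (K - n))
    have e : F.m + K - (K - n) = (F.m + n - s) + s := by omega
    rw [e, pow_add, ← mul_assoc]
    exact Nat.mul_lt_mul_of_pos_right (hg κ) (pow_pos (by have := F.hL.2; omega) _)
  rw [ZMod.val_natCast, Nat.mod_eq_of_lt hlt, mul_assoc]

end Member

end Summit.QuantumFields.YangMills.Theorems.Prop7Lane2PlateauCutoff

end
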